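import Literature.NumberTheory.LFunctions.BurnolZetaSystemsHardy
import Literature.NumberTheory.LFunctions.BurnolZetaSystemsProofs
import Literature.NumberTheory.LFunctions.SonineExtendedMellinContinuation
import Literature.NumberTheory.LFunctions.BurnolSonineChainDensityProofs
import Literature.Analysis.Fourier.L2FourierReflection
import Mathlib.Analysis.SpecialFunctions.Integrals.Basic
import Mathlib.Analysis.SpecialFunctions.Integrability.Basic
import Mathlib.Analysis.SpecialFunctions.ImproperIntegrals
import HarnessLib

/-!
# `Burnol2004b_prop4_1` is false AS TYPED (modulo the printed Props. 2.2 and 4.5): the kernel negative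
# of record for GAP G-dbl-27 (a junk value at the removable singularity `s = 1`)

LINE 1 — LABEL: RH-FREE typing hygiene (an unconditional implication between three typed RH-FREE
statements of Burnol 2004; `ζ` does not occur). FRAMING (cell rh-crit, D-0074): corpus theorems are
RH-FREE literature. bears_on: B-C/B-P (LADDER-RH COLUMN 6, de Branges framework) as bookkeeping only.
WHAT THIS IS NOT: not an error in Burnol's paper — the printed Prop. 4.1 is fine; what fails is OUR typing
`Burnol2004b_prop4_1` (dbl-t14 g0, p422227), which placed the removable singularity `s = 1` of
`a^s·((s−1)/s)·f̂(s)` inside the domain where `IsHardyRight` demands differentiability (finding: gm-t8 g3,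
2026-08-26T11:06Z; ruling dbl-lead g2 11:10Z/11:20Z; repaired statement `Burnol2004b_prop4_1R`, gm-t8 g3).
Nothing here bears on the truth of RH.

Source: J.-F. Burnol, *Two complete and minimal systems associated with the zeros of the Riemann zeta
function*, J. Théor. Nombres Bordeaux 16 (2004) 65–94 = arXiv:math/0203120v7 [Burnol2004b], Prop. 4.1
(TeX l.646–669; `L̂_a = (s/(s−1))A^sℍ² ∩ …`, TeX l.638–643), Prop. 2.2 (TeX l.460–469), Prop. 4.5
(`dim L_a/K_a = 2`, TeX l.760–786).

PROVED (no definitions, no new named facts):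
`Burnol2004b_prop4_1_false_of : Burnol2004b_prop2_2 → Burnol2004b_prop4_5 → ¬ Burnol2004b_prop4_1`,
and — both hypotheses being tree theorems since `Burnol2004b_prop2_2_holds` (dbl-t14 g3,
`SonineExtendedMellinContinuation.lean`) and `Burnol2004b_prop4_5_holds` (gm-t12 g2,
`BurnolSonineChainDensityProofs.lean`) — the UNCONDITIONAL kernel negative
`Burnol2004b_prop4_1_false : ¬ Burnol2004b_prop4_1` (REFUTED-AS-TYPED; superseded by `Burnol2004b_prop4_1R`).
Mechanism: for `f ∈ L_a` with `f = c` a.e. on `(0,a)`, `f̂(σ) = c·a^{1−σ}/(1−σ) + ∫_a^∞ t^{−σ}f(t)dt` for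
real `σ ∈ (1/2,1)` with the tail bounded near `σ = 1` (Cauchy–Schwarz against `t^{−1} + t^{−3/4} ∈ L²(a,∞)`),
so the typed `ℍ²`-member `F(s) = a^s((s−1)/s)·rightMellinExt f s` — equal to `a^s((s−1)/s)f̂(s)` on the
strip once a continuation exists (Prop. 2.2 (i)) — tends to `−c·a` along `σ_n = 1 − 1/(n+4)`, while
`F(1) = 0` and clause (i) makes `F` continuous at `1`: impossible for `c ≠ 0`. Prop. 4.5 supplies
`u ∈ L_a ∖ K_a`, i.e. `c_u ≠ 0` or `c_{𝓕u} ≠ 0` (`𝓕u ∈ L_a` by `fourierL2_even` and `𝓕𝓕u = u`), and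
clause (i) is stated for both `u` and `𝓕u`. Both hypotheses are needed as typed: without Prop. 2.2 (i)
`rightMellinExt u` is `Classical.epsilon` junk (e.g. `≡ 0`, for which clause (i) holds); without an
element of `L_a ∖ K_a` clause (i) is true (on `K_a`, by Plancherel).
-/

noncomputable section

open _root_.MeasureTheory _root_.Complex _root_.Filter _root_.Set FourierTransform
open scoped Topology Real ENNReal

namespace Literature.NumberTheory.LFunctions

/-- `𝓕𝓕F = F` for an a.e.-even `F ∈ L²(ℝ)`. [folklore] -/
private theorem fourier_fourier_of_even {F : Lp ℂ 2 (volume : Measure ℝ)}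
    (hF : ∀ᵐ x : ℝ, (F : ℝ → ℂ) (-x) = (F : ℝ → ℂ) x) :
    (𝓕 (𝓕 F : Lp ℂ 2 (volume : Measure ℝ)) : Lp ℂ 2 (volume : Measure ℝ)) = F := by
  rw [Literature.Analysis.Fourier.fourier_fourier_eq_compNeg]
  apply Lp.ext
  filter_upwards [Literature.Analysis.Fourier.coeFn_compNeg F, hF] with x h1 h2
  rw [h1, h2]

/-- `t ↦ t^{-r}` is in `L²(a,∞)` for `r > 1/2`, `a > 0`. [folklore] -/
private theorem memLp_rpow_neg_Ioi {a : ℝ} (ha : 0 < a) {r : ℝ} (hr : 1 / 2 < r) :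
    MemLp (fun t : ℝ ↦ t ^ (-r)) 2 (volume.restrict (Ioi a)) := by
  have hc : ContinuousOn (fun t : ℝ ↦ t ^ (-r)) (Ioi a) := fun t ht ↦
    (Real.continuousAt_rpow_const _ _ (Or.inl (ha.trans ht).ne')).continuousWithinAt
  rw [memLp_two_iff_integrable_sq_norm (hc.aestronglyMeasurable measurableSet_Ioi)]
  refine ((integrableOn_Ioi_rpow_of_lt (show -(2 * r) < -1 by linarith) ha).congr_fun
    (fun t ht ↦ ?_) measurableSet_Ioi)
  have ht0 : 0 < t := ha.trans ht
  rw [Real.norm_eq_abs, abs_of_nonneg (Real.rpow_nonneg ht0.le _), ← Real.rpow_natCast,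
    ← Real.rpow_mul ht0.le]
  push_cast; ring_nf

/-- `t ↦ (t:ℂ)^{-x}` is in `L²(a,∞)` for `Re x > 1/2`, `a > 0`. [folklore] -/
private theorem memLp_cpow_neg_Ioi {a : ℝ} (ha : 0 < a) {x : ℂ} (hx : 1 / 2 < x.re) :
    MemLp (fun t : ℝ ↦ (t : ℂ) ^ (-x)) 2 (volume.restrict (Ioi a)) := by
  have hc : ContinuousOn (fun t : ℝ ↦ (t : ℂ) ^ (-x)) (Ioi a) := fun t ht ↦
    (continuousAt_ofReal_cpow_const _ _ (Or.inr (ha.trans ht).ne')).continuousWithinAt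
  rw [memLp_two_iff_integrable_sq_norm (hc.aestronglyMeasurable measurableSet_Ioi)]
  refine ((integrableOn_Ioi_rpow_of_lt (show -(2 * x.re) < -1 by linarith) ha).congr_fun
    (fun t ht ↦ ?_) measurableSet_Ioi)
  have ht0 : 0 < t := ha.trans ht
  rw [norm_cpow_eq_rpow_re_of_pos ht0, ← Real.rpow_natCast, ← Real.rpow_mul ht0.le]
  simp; ring_nf

/-- The `(a,∞)` part of the right Mellin transform, `H(x) = ∫_a^∞ t^{-x} f(t) dt`, is bounded for real
`x = σ ∈ [3/4, 1]` by a constant (domination by `(t^{-1} + t^{-3/4})‖f‖ ∈ L¹(a,∞)`). [folklore] -/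
private theorem exists_bound_tail {a : ℝ} (ha : 0 < a) (f : Lp ℂ 2 (volume : Measure ℝ)) :
    ∃ K : ℝ, 0 ≤ K ∧ ∀ σ : ℝ, 3 / 4 ≤ σ → σ ≤ 1 →
      ‖∫ t in Ioi a, (t : ℂ) ^ (-(σ : ℂ)) * (f : ℝ → ℂ) t‖ ≤ K := by
  set k : ℝ → ℝ := fun t ↦ t ^ (-(1 : ℝ)) + t ^ (-(3 / 4 : ℝ)) with hk
  have hk2 : MemLp k 2 (volume.restrict (Ioi a)) :=
    (memLp_rpow_neg_Ioi ha (by norm_num)).add (memLp_rpow_neg_Ioi ha (by norm_num))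
  have hfn : MemLp (fun t : ℝ ↦ ‖(f : ℝ → ℂ) t‖) 2 (volume.restrict (Ioi a)) :=
    ((Lp.memLp f).restrict (Ioi a)).norm
  have hprod : Integrable (fun t : ℝ ↦ k t * ‖(f : ℝ → ℂ) t‖) (volume.restrict (Ioi a)) :=
    hk2.integrable_mul hfn
  refine ⟨∫ t in Ioi a, k t * ‖(f : ℝ → ℂ) t‖, setIntegral_nonneg measurableSet_Ioi fun t ht ↦ ?_,
    fun σ h1 h2 ↦ ?_⟩
  · have ht0 : 0 < t := ha.trans ht
    exact mul_nonneg (add_nonneg (Real.rpow_nonneg ht0.le _) (Real.rpow_nonneg ht0.le _))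
      (norm_nonneg _)
  · refine norm_integral_le_of_norm_le hprod ?_
    filter_upwards [ae_restrict_mem measurableSet_Ioi] with t ht
    have ht0 : 0 < t := ha.trans ht
    rw [norm_mul, norm_cpow_eq_rpow_re_of_pos ht0]
    simp only [neg_re, ofReal_re]
    refine mul_le_mul_of_nonneg_right ?_ (norm_nonneg _)
    rw [hk]; simp only
    by_cases ht1 : 1 ≤ t
    · calc t ^ (-σ) ≤ t ^ (-(3 / 4 : ℝ)) := Real.rpow_le_rpow_of_exponent_le ht1 (by linarith)
        _ ≤ t ^ (-(1 : ℝ)) + t ^ (-(3 / 4 : ℝ)) := le_add_of_nonneg_left (Real.rpow_nonneg ht0.le _)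
    · calc t ^ (-σ) ≤ t ^ (-(1 : ℝ)) :=
          Real.rpow_le_rpow_of_exponent_ge ht0 (le_of_not_ge ht1) (by linarith)
        _ ≤ t ^ (-(1 : ℝ)) + t ^ (-(3 / 4 : ℝ)) := le_add_of_nonneg_right (Real.rpow_nonneg ht0.le _)

/-- For `f ∈ L²` with `f = c` a.e. on `(0,a)` and real `σ ∈ (1/2, 1)`: the right Mellin transform splits as
`f̂(σ) = mellin f (1 - σ) = c·a^{1-σ}/(1-σ) + ∫_a^∞ t^{-σ} f(t) dt`. [folklore] -/
private theorem rightMellin_eq_of_const {a : ℝ} (ha : 0 < a) (f : Lp ℂ 2 (volume : Measure ℝ)) {c : ℂ}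
    (hfc : ∀ᵐ x : ℝ, x ∈ Ioo 0 a → (f : ℝ → ℂ) x = c) {σ : ℝ} (h1 : 1 / 2 < σ) (h2 : σ < 1) :
    rightMellin (f : ℝ → ℂ) (σ : ℂ) =
      c * (a : ℂ) ^ (1 - (σ : ℂ)) / (1 - (σ : ℂ)) +
        ∫ t in Ioi a, (t : ℂ) ^ (-(σ : ℂ)) * (f : ℝ → ℂ) t := by
  rw [rightMellin, mellin]
  have hexp : (1 : ℂ) - σ - 1 = -(σ : ℂ) := by ring
  simp only [hexp, smul_eq_mul]
  -- integrability on the two pieces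
  have hIoo : IntegrableOn (fun t : ℝ ↦ (t : ℂ) ^ (-(σ : ℂ)) * (f : ℝ → ℂ) t) (Ioo 0 a) := by
    have h0 : IntegrableOn (fun t : ℝ ↦ c * (t : ℂ) ^ (-(σ : ℂ))) (Ioo 0 a) := by
      refine Integrable.const_mul ?_ c
      exact (intervalIntegral.integrableOn_Ioo_cpow_iff ha).mpr (by simp; linarith)
    refine h0.congr_fun_ae ?_
    filter_upwards [ae_restrict_mem measurableSet_Ioo, ae_restrict_of_ae (s := Ioo 0 a) hfc]
      with t ht htc
    rw [htc ht, mul_comm]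
  have hIoi : IntegrableOn (fun t : ℝ ↦ (t : ℂ) ^ (-(σ : ℂ)) * (f : ℝ → ℂ) t) (Ioi a) :=
    (memLp_cpow_neg_Ioi ha (x := (σ : ℂ)) (by simpa using h1)).integrable_mul
      ((Lp.memLp f).restrict (Ioi a))
  have hIci : IntegrableOn (fun t : ℝ ↦ (t : ℂ) ^ (-(σ : ℂ)) * (f : ℝ → ℂ) t) (Ici a) :=
    hIoi.congr_set_ae Ioi_ae_eq_Ici.symm
  have hdisj : Disjoint (Ioo 0 a) (Ici a) :=
    Set.disjoint_left.mpr fun t ht ht' ↦ (not_le.mpr ht.2) ht'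
  rw [← Ioo_union_Ici_eq_Ioi ha, setIntegral_union hdisj measurableSet_Ici
    hIoo hIci, setIntegral_congr_set (Ioi_ae_eq_Ici (a := a)).symm]
  congr 1
  -- the `(0,a)` piece
  have e1 : ∫ t in Ioo 0 a, (t : ℂ) ^ (-(σ : ℂ)) * (f : ℝ → ℂ) t =
      ∫ t in Ioo 0 a, c * (t : ℂ) ^ (-(σ : ℂ)) := by
    refine setIntegral_congr_ae measurableSet_Ioo ?_
    filter_upwards [hfc] with t htc ht
    rw [htc ht, mul_comm]
  rw [e1, integral_const_mul, setIntegral_congr_set Ioo_ae_eq_Ioc,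
    ← intervalIntegral.integral_of_le ha.le, integral_cpow (Or.inl (by simp; linarith))]
  have hne : -(σ : ℂ) + 1 ≠ 0 := by
    intro h; have := congrArg Complex.re h; simp at this; linarith
  rw [Complex.ofReal_zero, Complex.zero_cpow hne, sub_zero,
    show -(σ : ℂ) + 1 = 1 - σ by ring, mul_div_assoc]

/-- **Core of the refutation.** If `f ∈ L²` equals the constant `c ≠ 0` a.e. on `(0,a)` and `f̂` HAS a
holomorphic continuation to `ℂ ∖ {1}` (so that `rightMellinExt f = f̂` on the strip), then the typed
`ℍ²`-member `s ↦ a^s·((s−1)/s)·rightMellinExt f s` is NOT in `ℍ²` as typed: it is discontinuous at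
`s = 1` (value `0`, limit `−c·a`). [folklore] -/
private theorem not_isHardyRight_of_const {a : ℝ} (ha : 0 < a) (f : Lp ℂ 2 (volume : Measure ℝ))
    {c : ℂ} (hfc : ∀ᵐ x : ℝ, x ∈ Ioo 0 a → (f : ℝ → ℂ) x = c) (hc : c ≠ 0)
    (hG : ∃ G, HasRightMellinContinuation (f : ℝ → ℂ) G) :
    ¬ IsHardyRight (fun s ↦ (a : ℂ) ^ s * ((s - 1) / s) * rightMellinExt (f : ℝ → ℂ) s) := by
  intro hH
  set F : ℂ → ℂ := fun s ↦ (a : ℂ) ^ s * ((s - 1) / s) * rightMellinExt (f : ℝ → ℂ) s with hFdef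
  have hR := hasRightMellinContinuation_rightMellinExt hG
  -- continuity of `F` at `1`, `F 1 = 0`
  have hopen : IsOpen {s : ℂ | 1 / 2 < s.re} := isOpen_lt continuous_const Complex.continuous_re
  have hcont : ContinuousAt F 1 :=
    (hH.1.differentiableAt (hopen.mem_nhds (show (1 : ℂ) ∈ {s : ℂ | 1 / 2 < s.re} by
      simp only [mem_setOf_eq, one_re]; norm_num))).continuousAt
  have hF1 : F 1 = 0 := by simp [hFdef]
  -- the sequence `σ_n = 1 - 1/(n+4)` (real, in `[3/4, 1)`)
  set σ : ℕ → ℝ := fun n ↦ 1 - 1 / ((n : ℝ) + 4) with hσ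
  have hσ1 : ∀ n, σ n < 1 := fun n ↦ by
    rw [hσ]; simp only; have : (0 : ℝ) < 1 / ((n : ℝ) + 4) := by positivity
    linarith
  have hσ34 : ∀ n, 3 / 4 ≤ σ n := fun n ↦ by
    rw [hσ]; simp only
    have h4 : (4 : ℝ) ≤ (n : ℝ) + 4 := by linarith [n.cast_nonneg (α := ℝ)]
    have : 1 / ((n : ℝ) + 4) ≤ 1 / 4 := one_div_le_one_div_of_le (by norm_num) h4
    linarith
  have hσpos : ∀ n, 0 < σ n := fun n ↦ by linarith [hσ34 n]
  have hσt : Tendsto σ atTop (𝓝 1) := by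
    have h0 : Tendsto (fun n : ℕ ↦ 1 / ((n : ℝ) + 4)) atTop (𝓝 0) := by
      have := (tendsto_one_div_add_atTop_nhds_zero_nat (𝕜 := ℝ)).comp (tendsto_add_atTop_nat 3)
      refine this.congr fun n ↦ ?_
      simp only [Function.comp_apply]; push_cast; ring
    have h1 := (tendsto_const_nhds (x := (1 : ℝ))).sub h0
    rw [sub_zero] at h1
    rw [hσ]; exact h1
  have hxt : Tendsto (fun n ↦ ((σ n : ℝ) : ℂ)) atTop (𝓝 (1 : ℂ)) := by
    have h1 := (continuous_ofReal.tendsto (1 : ℝ)).comp hσt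
    rw [ofReal_one] at h1
    exact h1
  -- `F(σ_n) → F 1 = 0`
  have hlim0 : Tendsto (fun n ↦ F (σ n)) atTop (𝓝 0) := by
    rw [← hF1]; exact hcont.tendsto.comp hxt
  -- the explicit form of `F(σ_n)`
  obtain ⟨K, hK0, hK⟩ := exists_bound_tail ha f
  set Hf : ℕ → ℂ := fun n ↦ ∫ t in Ioi a, (t : ℂ) ^ (-((σ n : ℝ) : ℂ)) * (f : ℝ → ℂ) t with hHf
  have hform : ∀ n, F (σ n) = -(c * a) / (σ n : ℂ) +
      (a : ℂ) ^ ((σ n : ℝ) : ℂ) * (((σ n : ℂ) - 1) / (σ n : ℂ)) * Hf n := by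
    intro n
    have hx1 : ((σ n : ℝ) : ℂ) ≠ 1 := by
      intro h; have := congrArg Complex.re h; simp at this; exact (hσ1 n).ne this
    have hx0 : ((σ n : ℝ) : ℂ) ≠ 0 := by exact_mod_cast (hσpos n).ne'
    have hstrip := hR.2 ((σ n : ℝ) : ℂ) (by simp; linarith [hσ34 n]) (by simp; exact hσ1 n)
    rw [hFdef]; simp only
    rw [hstrip, rightMellin_eq_of_const ha f hfc (by linarith [hσ34 n]) (hσ1 n), mul_add, hHf]
    congr 1
    have ha0 : (a : ℂ) ≠ 0 := by exact_mod_cast ha.ne'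
    have hpow : (a : ℂ) ^ ((σ n : ℝ) : ℂ) * (a : ℂ) ^ (1 - ((σ n : ℝ) : ℂ)) = a := by
      rw [← cpow_add _ _ ha0, add_sub_cancel, cpow_one]
    have h1x : (1 : ℂ) - (σ n : ℂ) ≠ 0 := sub_ne_zero.mpr (Ne.symm hx1)
    have key : (a : ℂ) ^ ((σ n : ℝ) : ℂ) * ((((σ n : ℝ) : ℂ) - 1) / ((σ n : ℝ) : ℂ)) *
        (c * (a : ℂ) ^ (1 - ((σ n : ℝ) : ℂ)) / (1 - ((σ n : ℝ) : ℂ))) =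
        ((((σ n : ℝ) : ℂ) - 1) / (1 - ((σ n : ℝ) : ℂ))) * (c / ((σ n : ℝ) : ℂ)) *
          ((a : ℂ) ^ ((σ n : ℝ) : ℂ) * (a : ℂ) ^ (1 - ((σ n : ℝ) : ℂ))) := by ring
    have hm1 : (((σ n : ℝ) : ℂ) - 1) / (1 - ((σ n : ℝ) : ℂ)) = -1 := by
      rw [← neg_sub, neg_div, div_self h1x]
    rw [key, hpow, hm1]
    field_simp
  -- the remainder tends to `0`
  have hrem : Tendsto (fun n ↦ (a : ℂ) ^ ((σ n : ℝ) : ℂ) * (((σ n : ℂ) - 1) / (σ n : ℂ)) * Hf n)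
      atTop (𝓝 0) := by
    have hbound : ∀ n, ‖(a : ℂ) ^ ((σ n : ℝ) : ℂ) * (((σ n : ℂ) - 1) / (σ n : ℂ)) * Hf n‖ ≤
        (max 1 a) * (4 / 3) * K * (1 - σ n) := by
      intro n
      have hapow : ‖(a : ℂ) ^ ((σ n : ℝ) : ℂ)‖ ≤ max 1 a := by
        rw [norm_cpow_eq_rpow_re_of_pos ha]; simp only [ofReal_re]
        by_cases ha1 : a ≤ 1
        · exact (Real.rpow_le_one ha.le ha1 (hσpos n).le).trans (le_max_left _ _)
        · exact (Real.rpow_le_rpow_of_exponent_le (le_of_not_ge ha1) (hσ1 n).le).trans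
            (by rw [Real.rpow_one]; exact le_max_right _ _)
      have hfrac : ‖((σ n : ℂ) - 1) / (σ n : ℂ)‖ ≤ (4 / 3) * (1 - σ n) := by
        rw [norm_div, show ((σ n : ℂ) - 1) = (((σ n - 1 : ℝ)) : ℂ) by push_cast; ring,
          Complex.norm_real, Complex.norm_real, Real.norm_eq_abs, Real.norm_eq_abs,
          abs_of_neg (by linarith [hσ1 n]), abs_of_pos (hσpos n), div_le_iff₀ (hσpos n)]
        nlinarith [hσ34 n, hσ1 n]
      have hH : ‖Hf n‖ ≤ K := hK (σ n) (hσ34 n) (hσ1 n).le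
      calc ‖(a : ℂ) ^ ((σ n : ℝ) : ℂ) * (((σ n : ℂ) - 1) / (σ n : ℂ)) * Hf n‖
          = ‖(a : ℂ) ^ ((σ n : ℝ) : ℂ)‖ * ‖((σ n : ℂ) - 1) / (σ n : ℂ)‖ * ‖Hf n‖ := by
            rw [norm_mul, norm_mul]
        _ ≤ (max 1 a) * ((4 / 3) * (1 - σ n)) * K := by
            refine mul_le_mul (mul_le_mul hapow hfrac (norm_nonneg _)
              (le_trans zero_le_one (le_max_left _ _))) hH (norm_nonneg _) ?_
            exact mul_nonneg (le_trans zero_le_one (le_max_left _ _))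
              (mul_nonneg (by norm_num) (by linarith [hσ1 n]))
        _ = (max 1 a) * (4 / 3) * K * (1 - σ n) := by ring
    refine squeeze_zero_norm hbound ?_
    have : Tendsto (fun n ↦ (max 1 a) * (4 / 3) * K * (1 - σ n)) atTop
        (𝓝 ((max 1 a) * (4 / 3) * K * (1 - 1))) :=
      tendsto_const_nhds.mul (tendsto_const_nhds.sub hσt)
    simpa using this
  -- the main term tends to `-c a`
  have hmain : Tendsto (fun n ↦ -(c * a) / (σ n : ℂ)) atTop (𝓝 (-(c * a))) := by
    have h1 := (tendsto_const_nhds (x := -(c * (a : ℂ)))).div hxt one_ne_zero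
    rw [div_one] at h1
    exact h1
  have hlim1 : Tendsto (fun n ↦ F (σ n)) atTop (𝓝 (-(c * a))) := by
    have := hmain.add hrem
    rw [add_zero] at this
    exact this.congr fun n ↦ (hform n).symm
  have heq := tendsto_nhds_unique hlim0 hlim1
  have : c * (a : ℂ) = 0 := by rw [← neg_eq_zero, ← heq]
  rcases mul_eq_zero.mp this with h | h
  · exact hc h
  · exact ha.ne' (by exact_mod_cast h)

/-- **`Burnol2004b_prop4_1` is FALSE AS TYPED, modulo the printed Props. 2.2 and 4.5** (kernel negative
of record for GAP G-dbl-27). Printed Prop. 4.1: "The subspace `L̂_a` … consists of the functions `F(s)` …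
which belong to `(s/(s−1))A^sℍ²` …" — the typed clause (i) asks `IsHardyRight (s ↦ a^s·((s−1)/s)·G_f(s))`,
i.e. differentiability on the open half-plane `Re s > 1/2 ∋ 1`, where the typed member has the junk value
`0` while its limit is `−a·c_f` (`c_f` = the constant value of `f` on `(0,a)`, `Res_{s=1} f̂ = −c_f`).
Given Prop. 2.2 (i) (existence of the continuation `G_f` of `f̂` to `ℂ ∖ {1}` for `f ∈ L_a`, which pins
`rightMellinExt f = f̂` on the strip) and Prop. 4.5 (`dim L_a/K_a = 2`, which supplies `u ∈ L_a ∖ K_a`,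
i.e. `c_u ≠ 0` or `c_{𝓕u} ≠ 0`), clause (i) fails for `u` or for `𝓕u ∈ L_a`. The repaired statement is
`Burnol2004b_prop4_1R` (pole-tolerant / strip phrasing). [cite: Burnol2004b, Prop. 4.1, Prop. 2.2, Prop. 4.5 (arXiv:math/0203120v7 pp. 5, 7, 9; TeX l.460–469, 638–669, 760–786)] -/
theorem Burnol2004b_prop4_1_false_of (h22 : Burnol2004b_prop2_2) (h45 : Burnol2004b_prop4_5) :
    ¬ Burnol2004b_prop4_1 := by
  intro h41
  obtain ⟨u, hu, v, -, hind, -⟩ := h45 1 one_pos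
  have huK : u ∉ sonineK 1 := fun h ↦ by
    have h' : (1 : ℂ) • u + (0 : ℂ) • v ∈ sonineK 1 := by simpa using h
    exact one_ne_zero (hind 1 0 h').1
  obtain ⟨hueven, ⟨c, hc⟩, ⟨c', hc'⟩⟩ := hu
  have hcc : c ≠ 0 ∨ c' ≠ 0 := by
    by_contra h
    simp only [not_or, ne_eq, not_not] at h
    obtain ⟨rfl, rfl⟩ := h
    exact huK ⟨hueven, hc, hc'⟩
  obtain ⟨h41i, -, -⟩ := h41 1 one_pos
  obtain ⟨hH1, hH2⟩ := h41i u ⟨hueven, ⟨c, hc⟩, ⟨c', hc'⟩⟩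
  obtain ⟨h22i, -⟩ := h22 1 one_pos
  rcases hcc with hc0 | hc0'
  · obtain ⟨G, hG, -⟩ := h22i u ⟨hueven, ⟨c, hc⟩, ⟨c', hc'⟩⟩
    exact not_isHardyRight_of_const one_pos u hc hc0 ⟨G, hG⟩ (by simpa using hH1)
  · have hFF : (𝓕 (𝓕 u : Lp ℂ 2 (volume : Measure ℝ)) : Lp ℂ 2 (volume : Measure ℝ)) = u :=
      fourier_fourier_of_even hueven
    have hFu : (𝓕 u : Lp ℂ 2 (volume : Measure ℝ)) ∈ sonineL 1 :=
      ⟨fourierL2_even hueven, ⟨c', hc'⟩, ⟨c, by rw [hFF]; exact hc⟩⟩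
    obtain ⟨G, hG, -⟩ := h22i _ hFu
    exact not_isHardyRight_of_const one_pos _ hc' hc0' ⟨G, hG⟩ (by simpa using hH2)

/-- **`Burnol2004b_prop4_1` is FALSE AS TYPED — unconditionally** (the kernel negative of record for GAP
G-dbl-27, now that both printed inputs are tree theorems: Prop. 2.2 = `Burnol2004b_prop2_2_holds`,
Prop. 4.5 = `Burnol2004b_prop4_5_holds`). What fails is OUR typing (junk value `0` of
`a^s((s−1)/s)·G_f(s)` at the removable singularity `s = 1` inside the domain of `IsHardyRight`), not
Burnol's Prop. 4.1; the repaired statement is `Burnol2004b_prop4_1R`.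
[cite: Burnol2004b, Prop. 4.1, Prop. 2.2, Prop. 4.5 (arXiv:math/0203120v7 pp. 5, 7, 9; TeX l.460–469, 638–669, 760–786)] -/
theorem Burnol2004b_prop4_1_false : ¬ Burnol2004b_prop4_1 :=
  Burnol2004b_prop4_1_false_of Burnol2004b_prop2_2_holds Burnol2004b_prop4_5_holds

end Literature.NumberTheory.LFunctions
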